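import Summits.QuantumFields.BalabanUV.T4Continuum.Support.InsertionChannelFamilyComplexLinear
import Summits.QuantumFields.BalabanUV.T4Continuum.Support.InsertionChannelEndArithmetic

/-!
# InsertionChannelFamilyComplexArithmetic — NE5 ∕ U3: the channel road ON ROAD D's COMPLEX TWO-ROW CHART OF RECORD (leaf-06-g13's
# `InsertionChannelFamilyComplexLinear`, part 6) WITH THE ARITHMETIC LETTERS `ρ₀, k₀, B` ELIMINATED — this lineage's
# `B13StepEndArithmetic.reach_elim_iff` (p210647), `OutputRateArithmetic.reach_binders_exists` (p207722),
# `InsertionChannelEndArithmetic.rateWindow_nonempty_iff` (p219563) BY NAME; `∃ C₅` per slot package and the rate-window face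

Cell `pub-balaban`, unit `b2b-balaban-t4-ne5-formalise-leaf-10` (NE5 formalisation swarm, LEAF PROVER 10, gen 10; row O6-n NUMERICS =
leaves L10∕L11 of `SKELETON-NE5-P1`; lineage FOLLOWER under CLAIM RULE 1∕3 — the letters-free twin of a NEW END face carrying the five
arithmetic binders, this lineage's standing pattern: `InsertionChannelEndArithmetic` p219563, `InsertionChannelFamilyArithmetic` p229950,
`OutputRateFunctionalTablesTermwiseArithmetic` p230466; journal INTENT #3 in `CLAIMS.log`, leaf-06 lineage named).  Imports part 6 + this
lineage's `InsertionChannelEndArithmetic` ONLY; 0 `def`, 0 cite tag; Summits-side bookkeeping under the LEAN PLACEMENT RULE (NOT a Literature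
module); nothing landed is edited.  HONEST FRAMING: rung (B)+1 of the FINITE-VOLUME T⁴ continuum programme — NOT infinite volume, NOT a
mass gap, NOT the Clay problem, and **NOT A PROOF OF NE5** (NOT PRINTED; GAPS G-t4-U3-1) nor of NE9: both ENDs below are IMPLICATIONS whose
wall binders (representation of the two complex function tables `ℰA ∕ ℰB` through the Re∕Im tables at every point of the two-row chart,
admissibility, the two FIBRE envelopes of the rotated model `toStepModelRot P` of constant `G` (W2), the complex decay levels, W1 `hop`,
W4 `hinsRate`, the insertion IS the linear-extension complex channel insertion `insLinOfChannelC hadd hhom out`, locality ∕ step-sum ∕ size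
binder of the channel `T` on the two-row chart, weight dictionary, profile `τ ≤ c·ω^{k−j}`, and the real section `ι′` reading `EA ∕ EB` as
real parts) are DISPLAYED HYPOTHESES asserted nowhere.  HONEST DEPENDENCY (cell line, verbatim): continuum YM on T⁴ ⇐ BetaPertH ∧ nine
spine estimates (0/9 proved); BetaPertH ⇐ (D1) ∧ (D4) ∧ CAP+tail; G-an2-4 gates asym, D1 and NE2/3/4.

THE POINT (decls, not adjectives).  Part 6's END carries the five binders of this lineage's `arithmetic_letters_iff` (A5) at the insertion
profile `cA := √2·c` (the two rows read through one complex table) and `D := δ + δ′`: they are jointly satisfiable IFF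
**`√2·c·(EA₀ + E₀) < 1 − ω`** (REACH) and **`ω + G·√2·c·(1 − ω)∕(1 − ω − √2·c(EA₀ + E₀)) < θ′`** (SMALLNESS), and a target rate
`θ ≤ θ′ < 1` exists IFF **`√2·c·(G + EA₀ + E₀) < 1 − ω`** — A5∕A13 at the profile `√2·c`; census VALUES unchanged (0∕12).

WHAT THIS FILE DOES ([folklore] bookkeeping; 0 sorry; axioms ⊆ {propext, Classical.choice, Quot.sound}).
* `exists_ne5_reIm_of_pointwiseSlots_insLinC_fibre_scale` — part 6's END with the five binders over `ρ₀, k₀, B` REPLACED by `0 < θ < 1`,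
  `ω < 1` and the two strict size inequalities; every other binder VERBATIM; `∃ C₅, T4OutputRate.NE5 EA EB W κ θ′ C₅`.
* `exists_rate_lt_one_reIm_of_pointwiseSlots_insLinC_fibre_scale` — the reach face: `√2·c·(G + EA₀ + E₀) < 1 − ω` ⟹
  `∃ θ′ < 1, θ ≤ θ′ ∧ ∃ C₅, NE5 EA EB W κ θ′ C₅`.
NOT claimed: any estimate; any value of `G, c, ω, EA₀, E₀, δ, δ′`; that Bałaban's step or [II]'s pieces satisfy a binder; NE5; NE9.
Headline wording (owner R30 (ii) ∕ R35, c5): «NE5 channel road on the complex chart of Road D — arithmetic letters eliminated (junction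
bookkeeping)»; never «leaf instantiated»; 0∕12; spine 0∕9.
-/

noncomputable section

open scoped BigOperators
open Finset Function Metric Set Complex

namespace Summit.QuantumFields.BalabanUV.T4Continuum.InsertionChannelFamilyComplexArithmetic

open Literature.MathematicalPhysics.QuantumFieldTheory.Balaban1983to89
open Literature.MathematicalPhysics.QuantumFieldTheory.Balaban1983to89.T4OutputRate (Carriers Functional NE5)
open Literature.MathematicalPhysics.QuantumFieldTheory.Balaban1983to89.T4InputCauchyRateData (StepModel tableA tableB)
open Literature.MathematicalPhysics.QuantumFieldTheory.Balaban1983to89.T4HistoryLipschitzRecursion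
  (ChannelAdditive ChannelLocal ChannelStepSum ChannelSizeAtStepNN)
open Summit.QuantumFields.BalabanUV.T4Continuum.B13HistDatum (HistFrame Hist)
open Summit.QuantumFields.BalabanUV.T4Continuum.InsertionChannelReading (ChannelHomog)
open Summit.QuantumFields.BalabanUV.T4Continuum.OutputRateFunctionalTables
open Summit.QuantumFields.BalabanUV.T4Continuum.OutputRateFunctionalTablesPointwise (PointwiseSlots)
open Summit.QuantumFields.BalabanUV.T4Continuum.OutputRateFunctionalTablesComplex (reImTab)
open Summit.QuantumFields.BalabanUV.T4Continuum.OutputRateFunctionalTablesComplexPointwise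
open Summit.QuantumFields.BalabanUV.T4Continuum.InsertionChannelFamily
open Summit.QuantumFields.BalabanUV.T4Continuum.OutputRateArithmetic (reach_binders_exists)
open Summit.QuantumFields.BalabanUV.T4Continuum.B13StepEndArithmetic (reach_elim_iff smallness_of_gain)
open Summit.QuantumFields.BalabanUV.T4Continuum.InsertionChannelEndArithmetic (rateWindow_nonempty_iff)

variable {C : Carriers} {𝒰 ι : Type} {F : HistFrame C}
variable {T : ℕ → (ℕ → ℝ) → (𝒰 × Fin 2 → C.Dom → ℝ) → ι → ℝ} {out : 𝒰 × Fin 2 → F.Idx → ι}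
variable {Op : Type*} [NormedAddCommGroup Op] [NormedSpace ℂ Op] (P : PointwiseSlots C (𝒰 × Fin 2) Op (Hist F))

/-- [folklore] **PART 6's COMPLEX-CHART ROAD-D END THROUGH THE LINEAR-EXTENSION CHANNEL INSERTION, ARITHMETIC LETTERS ELIMINATED** —
leaf-06-g13's `InsertionChannelFamily.ne5_reIm_of_pointwiseSlots_insLinC_fibre_scale_nat` (part 6; the two-row chart `𝒰 × Fin 2` of record,
R49 (4); FIBRE envelopes of the rotated model, insertion letter `√2·c`) with its FIVE binders over `ρ₀, k₀, B` — `hρ₀`,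
`hnear : (δ + δ′)θ^{k₀} + √2·c·(EA₀ + E₀)∕(1 − ω) ≤ ρ₀`, `hB`, `hfirst`, `hsmall : ω + G∕(1 − ρ₀)·(√2·c) < θ′` — REPLACED by `0 < θ < 1`,
`ω < 1` and the TWO STRICT SIZE INEQUALITIES `√2·c·(EA₀ + E₀) < 1 − ω`, `ω + G·(√2·c)·(1 − ω)∕(1 − ω − √2·c·(EA₀ + E₀)) < θ′` (this lineage's
`B13StepEndArithmetic.reach_elim_iff` + `OutputRateArithmetic.reach_binders_exists` + `smallness_of_gain` BY NAME); every other binder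
VERBATIM (incl. the real-section binders `ι′, hιA, hιB` after the numerics).  `∃ C₅, NE5 EA EB W κ θ′ C₅`.  NOT a proof of NE5 ∕ NE9. -/
theorem exists_ne5_reIm_of_pointwiseSlots_insLinC_fibre_scale [Nonempty 𝒰]
    (hadd : ChannelAdditive (Set.univ : Set (𝒰 × Fin 2 → C.Dom → ℝ)) T)
    (hhom : ChannelHomog (Set.univ : Set (𝒰 × Fin 2 → C.Dom → ℝ)) T) {ℰA ℰB : (ℕ → ℝ) → 𝒰 → C.Dom → ℂ}
    {EA : Functional C C.BgA} {EB : Functional C C.BgB} {W : Set (ℕ → ℝ)}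
    {κ c ω G EA₀ E₀ δ δ' θ θ' : ℝ} {wt : ℕ → ι → ℝ} {τ : ℕ → ℕ → ℝ}
    (hbdA : ∀ g ∈ W, ∀ k, BddAbove (Set.range fun w => ‖P.insA g k (tableA (reImTab (C := C) ℰA) g PUnit.unit) w‖))
    (hbdB : ∀ g ∈ W, ∀ k, BddAbove (Set.range fun w => ‖P.insB g k (tableB (reImTab (C := C) ℰB) g PUnit.unit) w‖))
    (hrA : ∀ g ∈ W, ∀ (X : C.Dom) (u : 𝒰) (i : Fin 2), ℰA g u X =
      P.Out (C.scale X) (P.opA g (C.scale X) (u, i))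
        (P.insA g (C.scale X) (tableA (reImTab (C := C) ℰA) g PUnit.unit) (u, i)) X)
    (hrB : ∀ g ∈ W, ∀ (X : C.Dom) (u : 𝒰) (i : Fin 2), ℰB g u X =
      P.Out (C.scale X) (P.opB g (C.scale X) (u, i))
        (P.insB g (C.scale X) (tableB (reImTab (C := C) ℰB) g PUnit.unit) (u, i)) X)
    (hbase : ∀ k, ∀ g ∈ W, ∀ w,
      (P.opB g k w, P.insB g k (tableB (reImTab (C := C) ℰB) g PUnit.unit) w) ∈ P.Base k g w)
    (hopF : (toStepModelRot P).OpFibreEnvelope W κ G) (hhistF : (toStepModelRot P).HistFibreEnvelope W κ G)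
    (hdA : ∀ g ∈ W, ∀ (u : 𝒰) (X : C.Dom), ‖ℰA g u X‖ ≤ EA₀ * Real.exp (-(κ * C.d X)))
    (hdB : ∀ g ∈ W, ∀ (u : 𝒰) (X : C.Dom), ‖ℰB g u X‖ ≤ E₀ * Real.exp (-(κ * C.d X)))
    (hop : ∀ k, ∀ g ∈ W, ∀ w : 𝒰 × Fin 2, ‖P.opA g k w - P.opB g k w‖ ≤ δ * θ ^ k * P.rOp k)
    (hinsRate : ∀ k, ∀ g ∈ W, ∀ (t : C.Dom × (𝒰 × Fin 2) → ℝ), (∀ Y w, |t (Y, w)| ≤ E₀ * Real.exp (-(κ * C.d Y))) →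
      ∀ w, ‖P.insA g k t w - P.insB g k t w‖ ≤ δ' * θ ^ k * P.rHist k)
    (hins : ∀ k, ∀ g ∈ W, ∀ (t : C.Dom × (𝒰 × Fin 2) → ℝ) (w : 𝒰 × Fin 2),
      P.insA g k t w = insLinOfChannelC hadd hhom out g k t w)
    (hloc : ChannelLocal (Set.univ : Set (𝒰 × Fin 2 → C.Dom → ℝ)) T)
    (hsum : ChannelStepSum (Set.univ : Set (𝒰 × Fin 2 → C.Dom → ℝ)) T)
    (hsize : ChannelSizeAtStepNN (Set.univ : Set (𝒰 × Fin 2 → C.Dom → ℝ)) T κ wt τ) (hwt0 : ∀ k w i, 0 ≤ wt k (out w i))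
    (hwt : ∀ k w i, wt k (out w i) ≤ P.rHist (k + 1) * F.wt i) (hτ : ∀ k j, j ≤ k → τ k j ≤ c * ω ^ (k - j))
    (hG : 0 ≤ G) (hδ : 0 ≤ δ + δ') (hθ0 : 0 < θ) (hθ1 : θ < 1) (hθθ' : θ ≤ θ') (hθ'1 : θ' ≤ 1) (hc : 0 ≤ c) (hω : 0 < ω) (hω1 : ω < 1)
    (hh : Real.sqrt 2 * c * (EA₀ + E₀) < 1 - ω)
    (hsmall : ω + G * (Real.sqrt 2 * c) * (1 - ω) / (1 - ω - Real.sqrt 2 * c * (EA₀ + E₀)) < θ')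
    (ι' : C.BgB → 𝒰) (hιA : ∀ g ∈ W, ∀ (U : C.BgB) (X : C.Dom), EA g (C.transport U) X = (ℰA g (ι' U) X).re)
    (hιB : ∀ g ∈ W, ∀ (U : C.BgB) (X : C.Dom), EB g U X = (ℰB g (ι' U) X).re) :
    ∃ C₅, NE5 EA EB W κ θ' C₅ := by
  obtain ⟨ρ₀, hreach, hρ₀, hs⟩ := (reach_elim_iff (mul_nonneg hG (mul_nonneg (Real.sqrt_nonneg _) hc)) hω1).mpr ⟨hh, hsmall⟩
  obtain ⟨k₀, B, hB, hnear, hfirst⟩ := reach_binders_exists hδ hθ0 hθ1 hreach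
  exact ⟨_, ne5_reIm_of_pointwiseSlots_insLinC_fibre_scale_nat P hadd hhom hbdA hbdB hrA hrB hbase hopF hhistF hdA hdB hop hinsRate
    hins hloc hsum hsize hwt0 hwt hτ hG hδ hθ0.le hθθ' hθ'1 hc hω hρ₀ hnear hB hfirst (smallness_of_gain hs) ι' hιA hιB⟩

/-- [folklore] **THE REACH FACE OF PART 6's END** — for EVERY input rate `0 < θ < 1`, the ONE letter-free inequality
`√2·c·(G + EA₀ + E₀) < 1 − ω` (this lineage's `InsertionChannelEndArithmetic.rateWindow_nonempty_iff` at the profile `√2·c`) gives SOME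
target rate `θ′ < 1` with `θ ≤ θ′` and `∃ C₅, NE5 EA EB W κ θ′ C₅`; no `ρ₀, k₀, B, θ′` left. -/
theorem exists_rate_lt_one_reIm_of_pointwiseSlots_insLinC_fibre_scale [Nonempty 𝒰]
    (hadd : ChannelAdditive (Set.univ : Set (𝒰 × Fin 2 → C.Dom → ℝ)) T)
    (hhom : ChannelHomog (Set.univ : Set (𝒰 × Fin 2 → C.Dom → ℝ)) T) {ℰA ℰB : (ℕ → ℝ) → 𝒰 → C.Dom → ℂ}
    {EA : Functional C C.BgA} {EB : Functional C C.BgB} {W : Set (ℕ → ℝ)}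
    {κ c ω G EA₀ E₀ δ δ' θ : ℝ} {wt : ℕ → ι → ℝ} {τ : ℕ → ℕ → ℝ}
    (hbdA : ∀ g ∈ W, ∀ k, BddAbove (Set.range fun w => ‖P.insA g k (tableA (reImTab (C := C) ℰA) g PUnit.unit) w‖))
    (hbdB : ∀ g ∈ W, ∀ k, BddAbove (Set.range fun w => ‖P.insB g k (tableB (reImTab (C := C) ℰB) g PUnit.unit) w‖))
    (hrA : ∀ g ∈ W, ∀ (X : C.Dom) (u : 𝒰) (i : Fin 2), ℰA g u X =
      P.Out (C.scale X) (P.opA g (C.scale X) (u, i))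
        (P.insA g (C.scale X) (tableA (reImTab (C := C) ℰA) g PUnit.unit) (u, i)) X)
    (hrB : ∀ g ∈ W, ∀ (X : C.Dom) (u : 𝒰) (i : Fin 2), ℰB g u X =
      P.Out (C.scale X) (P.opB g (C.scale X) (u, i))
        (P.insB g (C.scale X) (tableB (reImTab (C := C) ℰB) g PUnit.unit) (u, i)) X)
    (hbase : ∀ k, ∀ g ∈ W, ∀ w,
      (P.opB g k w, P.insB g k (tableB (reImTab (C := C) ℰB) g PUnit.unit) w) ∈ P.Base k g w)
    (hopF : (toStepModelRot P).OpFibreEnvelope W κ G) (hhistF : (toStepModelRot P).HistFibreEnvelope W κ G)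
    (hdA : ∀ g ∈ W, ∀ (u : 𝒰) (X : C.Dom), ‖ℰA g u X‖ ≤ EA₀ * Real.exp (-(κ * C.d X)))
    (hdB : ∀ g ∈ W, ∀ (u : 𝒰) (X : C.Dom), ‖ℰB g u X‖ ≤ E₀ * Real.exp (-(κ * C.d X)))
    (hop : ∀ k, ∀ g ∈ W, ∀ w : 𝒰 × Fin 2, ‖P.opA g k w - P.opB g k w‖ ≤ δ * θ ^ k * P.rOp k)
    (hinsRate : ∀ k, ∀ g ∈ W, ∀ (t : C.Dom × (𝒰 × Fin 2) → ℝ), (∀ Y w, |t (Y, w)| ≤ E₀ * Real.exp (-(κ * C.d Y))) →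
      ∀ w, ‖P.insA g k t w - P.insB g k t w‖ ≤ δ' * θ ^ k * P.rHist k)
    (hins : ∀ k, ∀ g ∈ W, ∀ (t : C.Dom × (𝒰 × Fin 2) → ℝ) (w : 𝒰 × Fin 2),
      P.insA g k t w = insLinOfChannelC hadd hhom out g k t w)
    (hloc : ChannelLocal (Set.univ : Set (𝒰 × Fin 2 → C.Dom → ℝ)) T)
    (hsum : ChannelStepSum (Set.univ : Set (𝒰 × Fin 2 → C.Dom → ℝ)) T)
    (hsize : ChannelSizeAtStepNN (Set.univ : Set (𝒰 × Fin 2 → C.Dom → ℝ)) T κ wt τ) (hwt0 : ∀ k w i, 0 ≤ wt k (out w i))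
    (hwt : ∀ k w i, wt k (out w i) ≤ P.rHist (k + 1) * F.wt i) (hτ : ∀ k j, j ≤ k → τ k j ≤ c * ω ^ (k - j))
    (hG : 0 ≤ G) (hδ : 0 ≤ δ + δ') (hθ0 : 0 < θ) (hθ1 : θ < 1) (hc : 0 ≤ c) (hω : 0 < ω) (hω1 : ω < 1) (h : Real.sqrt 2 * c * (G + EA₀ + E₀) < 1 - ω)
    (ι' : C.BgB → 𝒰) (hιA : ∀ g ∈ W, ∀ (U : C.BgB) (X : C.Dom), EA g (C.transport U) X = (ℰA g (ι' U) X).re)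
    (hιB : ∀ g ∈ W, ∀ (U : C.BgB) (X : C.Dom), EB g U X = (ℰB g (ι' U) X).re) :
    ∃ θ' < 1, θ ≤ θ' ∧ ∃ C₅, NE5 EA EB W κ θ' C₅ := by
  obtain ⟨hh, hs⟩ := (rateWindow_nonempty_iff hω1 (mul_nonneg (Real.sqrt_nonneg _) hc) hG).2 h
  obtain ⟨θ', h1, h2⟩ := exists_between (max_lt hθ1 hs)
  exact ⟨θ', h2, (le_max_left _ _).trans h1.le, exists_ne5_reIm_of_pointwiseSlots_insLinC_fibre_scale P hadd hhom hbdA hbdB hrA hrB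
    hbase hopF hhistF hdA hdB hop hinsRate hins hloc hsum hsize hwt0 hwt hτ hG hδ hθ0 hθ1 ((le_max_left _ _).trans h1.le) h2.le hc hω
    hω1 hh ((le_max_right _ _).trans_lt h1) ι' hιA hιB⟩

end Summit.QuantumFields.BalabanUV.T4Continuum.InsertionChannelFamilyComplexArithmetic

end
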